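import Summits.ResolutionOfSingularities.ResolutionOfSingularities.Theorems.TightCutClasses
import HarnessLib

/-!
# HoleCutClasses — decomp-res node «HoleCut» (lens-3 g18, critic row 143), tree file 3/4 of the node

Content VERBATIM from the decomp-res lens-3 g18 file `HOME/decomp-res-lens-3/g18/HoleCut.lean` (sha256 55250664…,
3677 l; = `parts/HoleCut-NODE-55250664.lean`;
HOME = run/shared/lean/pub/decomp-res), NEW sections only: its carried l. 89–3133 are lens-3 g17 TightCut
@7fe2fb69 VERBATIM and ALREADY in the tree as
`Theorems/TightCut*` / `MaxContactCutTightCut` (and the g13–g16 chain below them) — not landed again; the §M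
root `closes` (≡ `MaxContactCutExponentLadder.closes`)
is not restated.  Critic: CRITIC-LEDGER row 143 (CLEARED 2026-08-30T20:55:21Z); landing plan NODE-g18 §6.  Landed
by decomp-res writer g7 in the lens's namespace
`…Theorems.HoleCut` with `open …Theorems.TightCut` (the carried decls resolve against the landed TightCut
files).  Aside budget: the g17 residual 28532
`TightNoJointTailsFromFourDeep` is KEPT as the one booked item and re-informalled with its EXACT two-piece form
`four_iff_hole` (pieces A `NoSubcriticalJointTailsDeep`,
B `NoHoleFillingTailsDeep`, both in the cone-free `HoleCutClasses`), per the critic's budget option.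

OUTSIDE the Theses cone (imports only the cone-free `TightCutClasses`; importable by the route file): §K4's two
located pieces of g17's residual
`TightCut.NoJointTailsFromFourDeep` cut by the critical line `q = 3s − 2` — PIECE A
`NoSubcriticalJointTailsDeep` (`q < 3s − 2`; UNDECIDED) and PIECE B
`NoHoleFillingTailsDeep` (`q ≥ 3s − 2`, `s ≥ 4`, hole-filling moves i.o.; UNDECIDED).  EXACT `four_iff_hole`
and the DECIDED complement
`NoSupercriticalHoleFreeJointTailsDeep` (a theorem) are in `MaxContactCutHoleCut`.

[WRITER NOTE (decomp-res writer g7): section split only; every declaration as in the lens except: the lens's private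
`eq_of_le_of_degree_le` (a `Fin 3` copy of the
tree's `ExitLaw.eq_of_le_of_degree_le`, opened here) is not restated; `chartExponent_of_ne` ↦ the landed
`ProximityCut.chartExponent_apply_ne` and `exists_third a b h` ↦
`ConeCut.exists_third h` exactly as in the landed TightCut files; global `set_option` dropped.]

(Sources: CossartPiltant2008 Prop. 4.2; CossartPiltant2009; CossartJannsenSaito2020; Hauser2010; Moh1987;
BenitoVillamayor2012; HauserPerlega2024.)
-/

noncomputable section

open MvPolynomial Finset
open Literature.AlgebraicGeometry.Resolution
open Literature.AlgebraicGeometry.Resolution.Hauser2010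
open Literature.AlgebraicGeometry.Resolution.PointBlowup
open Literature.AlgebraicGeometry.Resolution.WeightedBlowup
open Summit.ResolutionOfSingularities.ResolutionOfSingularities.Theorems.TightDefectClasses
open Summit.ResolutionOfSingularities.ResolutionOfSingularities.Theorems.ProximityCut
open Summit.ResolutionOfSingularities.ResolutionOfSingularities.Theorems.TightCut

namespace Summit.ResolutionOfSingularities.ResolutionOfSingularities.Theorems.HoleCut

section BookingHole

/-- PIECE A · THE LOCATED RESIDUAL, SUBCRITICAL PART — JOINT TAILS OF SHADE `s ≥ 3` AT A MODULUS `q = p^e < 3s − 2`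
(binders of the tree's joint residual `ExitLaw.NoRepeatTranslationRecurrentExcessPlateauxDeep` VERBATIM, plus
`shade_N = s`, `3 ≤ s`, `p^e + 3 ≤ 3s`) · WEAKER than `NoJointTailsFromFourDeep` by letter (`sub_of_four`) · UNDECIDED ·
INSTRUMENTABLE (it contains the cell `(q,s) = (4,3)` and EVERY census cell with `s ≥ 4`: `(8,4…6)`, `(9,4…8)`;
finite-profile entry: the H-bed arcs `H:1489`, `H:1490` at `(8,6)`). -/
def NoSubcriticalJointTailsDeep : Prop :=
  ∀ p : ℕ, p.Prime → ∀ e : ℕ, 2 ≤ e → ∀ (K : Type) [Field K] [CharP K p] [PerfectField K] [DecidableEq K]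
    (s₀ : State (Fin 3) K), IsRoot (p ^ e) s₀ → ∀ W : ForcedWalk (p ^ e) s₀, (∀ i, 1 ≤ (W.st i).shade) →
    ∀ N : ℕ, (∀ t, N ≤ t → (W.st (t + 1)).shade = (W.st t).shade) →
    (∀ t, N ≤ t → ordZero (W.st t).F ≠ ((p ^ e : ℕ) : ℕ∞)) → (∀ M : ℕ, ∃ t, M ≤ t ∧ StaysOnNewest W t) →
    (∀ M : ℕ, ∃ t, M ≤ t ∧ W.b t ≠ 0) →
    ∀ s : ℕ, (W.st N).shade = (s : ℕ∞) → 3 ≤ s → p ^ e + 3 ≤ 3 * s → False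

/-- PIECE B · THE LOCATED RESIDUAL, SUPERCRITICAL PART — HOLE-FILLING TAILS: joint tails of shade `s ≥ 4` at a
modulus `q = p^e ≥ 3s − 2` along which, infinitely often, a move `t+1` is HOLE-FILLING (untranslated, a chart change,
into a coordinate where the boundary vanishes) with its corner `D_{t+1}` INSIDE THE DEFICIT WINDOW
`q + 1 − s ≤ D_{t+1}`, `3 D_{t+1} + s + 3 ≤ 3q` (binders VERBATIM, plus that clause, tree letters only) · WEAKER than
`NoJointTailsFromFourDeep` by letter (`hole_of_four`) · UNDECIDED · IDEA-NEEDED (SEED-g19: the escape law of a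
hole-filling move at corner `q − 3`, shade `4` — the analogue of LAW J₂) · no census cell is supercritical with
`s ≥ 4` (the beds have `q ∈ {4, 8, 9}`), so this class has NO finite-profile inhabitant today (INBOX ask (c)). -/
def NoHoleFillingTailsDeep : Prop :=
  ∀ p : ℕ, p.Prime → ∀ e : ℕ, 2 ≤ e → ∀ (K : Type) [Field K] [CharP K p] [PerfectField K] [DecidableEq K]
    (s₀ : State (Fin 3) K), IsRoot (p ^ e) s₀ → ∀ W : ForcedWalk (p ^ e) s₀, (∀ i, 1 ≤ (W.st i).shade) →
    ∀ N : ℕ, (∀ t, N ≤ t → (W.st (t + 1)).shade = (W.st t).shade) →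
    (∀ t, N ≤ t → ordZero (W.st t).F ≠ ((p ^ e : ℕ) : ℕ∞)) → (∀ M : ℕ, ∃ t, M ≤ t ∧ StaysOnNewest W t) →
    (∀ M : ℕ, ∃ t, M ≤ t ∧ W.b t ≠ 0) →
    ∀ s : ℕ, (W.st N).shade = (s : ℕ∞) → 4 ≤ s → 3 * s ≤ p ^ e + 2 →
    (∀ M : ℕ, ∃ t, M ≤ t ∧ N ≤ t ∧ W.b (t + 1) = 0 ∧ W.j (t + 1) ≠ W.j t ∧ (W.st (t + 1)).r (W.j (t + 1)) = 0 ∧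
      p ^ e + 1 ≤ (W.st (t + 1)).r.degree + s ∧ 3 * (W.st (t + 1)).r.degree + s + 3 ≤ 3 * p ^ e) → False

end BookingHole

end Summit.ResolutionOfSingularities.ResolutionOfSingularities.Theorems.HoleCut
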